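import Mathlib.LinearAlgebra.FiniteDimensional.Lemmas
import Mathlib.LinearAlgebra.Dimension.Finrank
import Mathlib.Algebra.Group.Even
import Mathlib.Tactic.LinearCombination
import Mathlib.Tactic.Ring
import HarnessLib

/-!
# Route ByReductionTypeAtTwo, crux `RankOneAtTwoBigImageOddLocal` (stmt-BirchSwinnertonDyer-23715):
# the ALGEBRA of Kolyvagin's FIRST `2`-DESCENT OVER `ℚ` at a minimal door (lead report G10, §§2–3)

Lead prover seat `bsd-line-fkl-p1` g10 (2026-08-28), `--supports stmt-BirchSwinnertonDyer-23715` (helper).  Pure algebra; nothing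
about elliptic curves is asserted; BSD is not proved by any of this.  Kernel anchor for the lead report
`Cruxes/RankOneAtTwoBigImageOddLocal/OneDoorLeadReportG10.md`, which CORRECTS report G9's reading of the Euler-system half
`DoorIndexLawUpperCAtTwo` («beyond Kolyvagin's inert-prime method at 2»): pairing Kolyvagin's classes OVER `ℚ_ℓ` (not `K_λ`) loses
no bit when `Δ_E < 0`, and at a MINIMAL door (`t + 2s = [Δ_E < 0]`) the `m = 0` corner of the upper half is Kolyvagin's FIRST
`2`-descent plus Cassels–Tate parity.  The three ingredients that are pure algebra are proved here:

* §1 `kolyvagin_kappa_mul_frob` — the identity behind Gross 1991 Prop. 6.2 / McCallum 1991 Prop. 4.4 that needs NO `±`-eigenspace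
  and hence holds at `p = 2` for both signs of `Δ_E`: if `φ² − a φ + ℓ = 0` (Frobenius at a Kolyvagin prime, `M ∣ a`, `M ∣ ℓ + 1`)
  then `((ℓ+1)φ − a)·φ = ℓ·(aφ − (ℓ+1))`, i.e. `κ_M ∘ φ = ℓ·ψ_M` for `κ_M = ((ℓ+1)φ − a)/M` (Kolyvagin's map
  `E(K_λ)/M → Ẽ(𝔽_λ)[M]`) and `ψ_M = (aφ − (ℓ+1))/M = (φ² − 1)/M`; so `κ_M` is an isomorphism `T/MT ≅ ψT/MψT = Ẽ(𝔽_λ)[M]`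
  whenever `φ` and `ℓ` are invertible on `T` — no parity hypothesis on `p`.
* §2 `finrank_le_two_of_forall_ne_ne_apply_ne_zero` / `finrank_le_one_of_forall_ne_zero_apply_ne_zero` — the two counting steps
  of the first descent with ONE error place `q₀`: if every Selmer class `s ∉ {0, y}` (resp. every `s ≠ 0`) has non-zero image under
  the error functional `L = loc_{q₀}` (which is what Poitou–Tate with the Kolyvagin class `c(ℓ_s)` and the perfect `ℚ_ℓ`-pairing
  give), then `dim Sel₂(E/ℚ) ≤ 2` (resp. `dim Sel₂(E^{(d)}/ℚ) ≤ 1`).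
* §3 `eq_one_of_le_two_of_even_sub_one` / `eq_zero_of_le_one_of_even` — Cassels–Tate parity then closes the corner:
  `dim Sel₂(E/ℚ) = 1 + dim Ш(E)[2]` with `dim Ш(E)[2]` even forces `dim = 1`, and `dim Ш(E^{(d)})[2] ≤ 1` even forces `0`.

References: [GrossLMS1991] Props. 6.2, 8.1, §9; [McCallumLMS1991] Prop. 4.4; [Cassels1962ArithmeticIV] (alternating pairing on `Ш`).
-/

set_option autoImplicit false
-- the Theorems namespace of this sub repeats the summit name by design (D-0017 nested layout)
set_option linter.dupNamespace false

namespace Summit.BirchSwinnertonDyer.BirchSwinnertonDyer.Theorems.RankOneAtTwoOneDoor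

/-! ### §1 Kolyvagin's map at a Kolyvagin prime: the eigenspace-free identity (valid at `p = 2`) -/

/-- **`κ_M ∘ φ = ℓ · ψ_M` (times `M`), as a ring identity.**  For `φ` with `φ² − aφ + ℓ = 0` (the Frobenius of a Kolyvagin prime
`ℓ` on `T₂E`, `a = a_ℓ`): `((ℓ+1)φ − a)·φ = ℓ·(aφ − (ℓ+1))`.  Dividing by `M` (`M ∣ a`, `M ∣ ℓ+1`): Kolyvagin's map
`κ_M = ((ℓ+1)φ − a)/M` satisfies `κ_M ∘ φ = ℓ·ψ_M` with `M·ψ_M = φ² − 1`, so `κ_M : T/MT → ψ_M T/Mψ_M T = Ẽ(𝔽_λ)[M]` is a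
bijection as soon as `φ` and `ℓ` act invertibly — Gross's Prop. 6.2 step without the `±`-decomposition, hence at `p = 2` for both
signs of `Δ_E`. [cite: GrossLMS1991, Prop. 6.2] [cite: McCallumLMS1991, Prop. 4.4] -/
theorem kolyvagin_kappa_mul_frob {R : Type*} [CommRing R] (φ a ℓ : R) (h : φ ^ 2 - a * φ + ℓ = 0) :
    ((ℓ + 1) * φ - a) * φ = ℓ * (a * φ - (ℓ + 1)) := by
  linear_combination (ℓ + 1) * h

/-- The same identity with no hypothesis: `((ℓ+1)X − a)·X − ℓ·(aX − (ℓ+1)) = (ℓ+1)·(X² − aX + ℓ)` in any commutative ring.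
[cite: GrossLMS1991, Prop. 6.2] -/
theorem kolyvagin_kappa_mul_frob_sub {R : Type*} [CommRing R] (X a ℓ : R) :
    ((ℓ + 1) * X - a) * X - ℓ * (a * X - (ℓ + 1)) = (ℓ + 1) * (X ^ 2 - a * X + ℓ) := by
  ring

/-- `M·ψ_M = aφ − (ℓ+1)` IS `φ² − 1` on the nose when `φ² − aφ + ℓ = 0`: the target of `κ_M` is `(φ² − 1)T/M = Ẽ(𝔽_λ)[M]`
(`Ẽ(𝔽_λ)[2^∞] = T/(φ² − 1)T` at an inert Kolyvagin prime). [cite: GrossLMS1991, Prop. 6.2] -/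
theorem frob_sq_sub_one_eq {R : Type*} [CommRing R] (φ a ℓ : R) (h : φ ^ 2 - a * φ + ℓ = 0) :
    φ ^ 2 - 1 = a * φ - (ℓ + 1) := by
  linear_combination h

/-! ### §2 The two counting steps of the first descent with one error place -/

/-- **E-side count.**  `V = Sel₂(E/ℚ)` over `𝔽₂`, `y = δ(y_K)`, `L = loc_{q₀}` the error functional at the single transposition
prime of a minimal `Δ_E < 0` door.  Poitou–Tate with the Kolyvagin class `c(ℓ_s)` (chosen by Čebotarev with `loc_ℓ s ≠ 0`,
`loc_ℓ y ≠ 0`) gives `L s ≠ 0` for every `s ∉ {0, y}`; then `ker L ⊆ {0, y} ⊆ span {y}` and `dim V ≤ 1 + 1`.  Stated for any field.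
[cite: GrossLMS1991, §9 (the argument for Sel⁺)] -/
theorem finrank_le_two_of_forall_ne_ne_apply_ne_zero {K V : Type*} [Field K] [AddCommGroup V] [Module K V]
    [FiniteDimensional K V] (L : V →ₗ[K] K) (y : V) (h : ∀ s : V, s ≠ 0 → s ≠ y → L s ≠ 0) :
    Module.finrank K V ≤ 2 := by
  have hker : LinearMap.ker L ≤ K ∙ y := by
    intro s hs
    rw [LinearMap.mem_ker] at hs
    by_cases h0 : s = 0
    · rw [h0]; exact Submodule.zero_mem _
    · by_cases hy : s = y
      · rw [hy]; exact Submodule.mem_span_singleton_self y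
      · exact absurd hs (h s h0 hy)
  have h1 : Module.finrank K (LinearMap.ker L) ≤ 1 :=
    (Submodule.finrank_mono hker).trans ((finrank_span_le_card ({y} : Set V)).trans (by simp))
  have h2 : Module.finrank K (LinearMap.range L) ≤ 1 := by
    simpa using Submodule.finrank_le (LinearMap.range L)
  have h3 := LinearMap.finrank_range_add_finrank_ker L
  omega

/-- **Twin-side count.**  `V = Sel₂(E^{(d)}/ℚ)`, `L = loc_{q₀}`: Poitou–Tate with `c(ℓ_{s})` gives `L s ≠ 0` for every `s ≠ 0`
(the Heegner class `δ(y_K)` is NOT in `Sel₂(E^{(d)}/ℚ)`: its `q₀`-component is unramified and non-zero — Poitou–Tate applied to the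
pair `(δ y_K, c(ℓ))` itself — while the twisted Kummer line at `q₀` is transverse to the unramified line, Mazur–Rubin `h_{q₀} = 1`);
then `L` is injective and `dim V ≤ 1`. [cite: GrossLMS1991, §9 (the argument for Sel⁻)] [cite: MazurRubin2010, Lemma 2.9 / Prop. 3.3] -/
theorem finrank_le_one_of_forall_ne_zero_apply_ne_zero {K V : Type*} [Field K] [AddCommGroup V] [Module K V]
    [FiniteDimensional K V] (L : V →ₗ[K] K) (h : ∀ s : V, s ≠ 0 → L s ≠ 0) :
    Module.finrank K V ≤ 1 := by
  have hker : LinearMap.ker L = ⊥ := by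
    rw [Submodule.eq_bot_iff]
    intro s hs
    rw [LinearMap.mem_ker] at hs
    by_contra h0
    exact h s h0 hs
  have h1 : Module.finrank K (LinearMap.ker L) = 0 := by rw [hker, finrank_bot]
  have h2 : Module.finrank K (LinearMap.range L) ≤ 1 := by
    simpa using Submodule.finrank_le (LinearMap.range L)
  have h3 := LinearMap.finrank_range_add_finrank_ker L
  omega

/-! ### §3 Cassels–Tate parity closes the `m = 0` corner at a minimal door -/

/-- `dim Sel₂(E/ℚ) = 1 + dim Ш(E)[2]` (rank `1`, `E(ℚ)[2] = 0`) with `dim Ш(E)[2]` EVEN (Cassels–Tate, `Ш` finite by Kolyvagin) and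
`dim ≤ 2` (§2) force `dim Sel₂(E/ℚ) = 1`, i.e. `Ш(E/ℚ)[2] = 0`. [cite: Cassels1962ArithmeticIV, Thm. 1.1] -/
theorem eq_one_of_le_two_of_even_sub_one (d : ℕ) (h1 : 1 ≤ d) (h2 : d ≤ 2) (h3 : Even (d - 1)) : d = 1 := by
  obtain ⟨k, hk⟩ := h3
  omega

/-- `dim Sel₂(E^{(d)}/ℚ) = dim Ш(E^{(d)})[2]` (rank `0`, no rational `2`-torsion) EVEN and `≤ 1` (§2) force `Ш(E^{(d)}/ℚ)[2] = 0`.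
[cite: Cassels1962ArithmeticIV, Thm. 1.1] -/
theorem eq_zero_of_le_one_of_even (d : ℕ) (h2 : d ≤ 1) (h3 : Even d) : d = 0 := by
  obtain ⟨k, hk⟩ := h3
  omega

end Summit.BirchSwinnertonDyer.BirchSwinnertonDyer.Theorems.RankOneAtTwoOneDoor
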